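import Summits.AtomisticToContinuum.Crystallization.Theorems.ChessboardParticlePlanesPeriodicWindowsStubLayerData
import Summits.AtomisticToContinuum.Crystallization.Theorems.PhononSlackCertificatesPeriodicGivenLayeredWindowBounds
import Literature.Barriers.AtomisticToContinuum.StickySphereClustersNarrow

/-!
# Crux `PeriodicWindows` (stmt-AtomisticToContinuum-3240), line `dense-laminar-hull` — the compression competitor of the
# gap squeeze (`stub_gapSqueeze`, lead c11), part 1: compressed heights, parametrisation, termwise monotonicity

For a general layered set `S = B '' {i • v₁(a) + j • v₂(a) + δ m + z m • e₃}` (horizontal linear isometry `B`, horizontal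
offsets `δ`, strictly increasing heights `z` with gaps `≥ 3/4`) the COMPRESSED heights `z'` have the same layers and
increments `z' (m+1) - z' m = min (z (m+1) - z m) 1` (`gsc_exists_sq`, `gsc_compression`). Under the compression every
height difference weakly decreases and is `≥ 1` whenever it strictly decreases (`gsc_sq_abs`), hence so does every pair
distance of layered points (`gsc_dist_compare`), and the Lennard-Jones interaction of every pair weakly decreases
(`gsc_term_le`; `V_LJ` is increasing on `[1, ∞)`). Also: the parametrisation of a layered set by `ℤ³` is injective with
range the set (`gsc_param_injective`, `gsc_range_param`), and punctured site sums re-index over `ℤ³ ∖ {t₀}`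
(`gsc_reindex`). All elementary. [folklore]
-/

noncomputable section

namespace Summit.AtomisticToContinuum.Crystallization.Theorems.PeriodicWindowsDenseLaminarHull

open Literature.MathematicalPhysics.StatisticalMechanics Filter Metric
open scoped BigOperators


/-! ## Coordinates of layered points -/

/-- Third coordinate of `v₁(a)`. [folklore] -/
theorem gsc_triangularVec₁_two (a : ℝ) : (triangularVec₁ a) 2 = 0 := by
  simp [triangularVec₁]

/-- Third coordinate of `v₂(a)`. [folklore] -/
theorem gsc_triangularVec₂_two (a : ℝ) : (triangularVec₂ a) 2 = 0 := by
  simp [triangularVec₂]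

/-- Third coordinate of `t • e₃`. [folklore] -/
theorem gsc_smul_layerNormal_two (t : ℝ) : (t • layerNormal 1 : EuclideanSpace ℝ (Fin 3)) 2 = t := by
  simp [layerNormal]

/-- First coordinate of `t • e₃`. [folklore] -/
theorem gsc_smul_layerNormal_zero (t : ℝ) : (t • layerNormal 1 : EuclideanSpace ℝ (Fin 3)) 0 = 0 := by
  simp [layerNormal]

/-- Second coordinate of `t • e₃`. [folklore] -/
theorem gsc_smul_layerNormal_one (t : ℝ) : (t • layerNormal 1 : EuclideanSpace ℝ (Fin 3)) 1 = 0 := by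
  simp [layerNormal]

/-- The squared norm of a vector of `ℝ³` in coordinates. [folklore] -/
theorem gsc_norm_sq_eq (x : EuclideanSpace ℝ (Fin 3)) : ‖x‖ ^ 2 = (x 0) ^ 2 + (x 1) ^ 2 + (x 2) ^ 2 := by
  rw [EuclideanSpace.norm_eq, Real.sq_sqrt (Finset.sum_nonneg fun i _ => by positivity), Fin.sum_univ_three]
  simp [Real.norm_eq_abs, sq_abs]

/-- Pythagoras for a horizontal vector plus a vertical one: `‖h + t e₃‖² = ‖h‖² + t²`. [folklore] -/
theorem gsc_norm_sq_horiz_add (h : EuclideanSpace ℝ (Fin 3)) (hh : h 2 = 0) (t : ℝ) :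
    ‖h + t • layerNormal 1‖ ^ 2 = ‖h‖ ^ 2 + t ^ 2 := by
  rw [gsc_norm_sq_eq, gsc_norm_sq_eq h, PiLp.add_apply, PiLp.add_apply, PiLp.add_apply, hh,
    gsc_smul_layerNormal_zero, gsc_smul_layerNormal_one, gsc_smul_layerNormal_two]
  ring

/-! ## The compressed heights -/

/-- **Existence of the compressed heights**: there is `z' : ℤ → ℝ` with `z' 0 = 0` and increments
`z' (m+1) - z' m = min (z (m+1) - z m) 1` (partial sums of the truncated increments, upwards and downwards from `0`).
[folklore] -/
theorem gsc_exists_sq (z : ℤ → ℝ) : ∃ z' : ℤ → ℝ, z' 0 = 0 ∧ ∀ m : ℤ, z' (m + 1) - z' m = min (z (m + 1) - z m) 1 := by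
  set up : ℕ → ℝ := fun n => ∑ k ∈ Finset.range n, min (z ((k : ℤ) + 1) - z (k : ℤ)) 1 with hup
  set dn : ℕ → ℝ := fun n => ∑ k ∈ Finset.range n, min (z (-(k : ℤ)) - z (-(k : ℤ) - 1)) 1 with hdn
  refine ⟨fun m => if 0 ≤ m then up m.toNat else -dn (-m).toNat, by simp [hup], fun m => ?_⟩
  have hup_succ : ∀ n : ℕ, up (n + 1) - up n = min (z ((n : ℤ) + 1) - z (n : ℤ)) 1 := fun n => by
    simp only [hup, Finset.sum_range_succ]; ring
  have hdn_succ : ∀ n : ℕ, dn (n + 1) - dn n = min (z (-(n : ℤ)) - z (-(n : ℤ) - 1)) 1 := fun n => by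
    simp only [hdn, Finset.sum_range_succ]; ring
  rcases lt_trichotomy m (-1) with hm | rfl | hm
  · -- `m ≤ -2`
    have h1 : ¬ (0 ≤ m + 1) := by omega
    have h2 : ¬ (0 ≤ m) := by omega
    simp only [h1, h2, if_false]
    obtain ⟨n, hn⟩ : ∃ n : ℕ, (-(m + 1)).toNat = n := ⟨_, rfl⟩
    have hn' : (-m).toNat = n + 1 := by omega
    have hmn : (n : ℤ) = -(m + 1) := by omega
    rw [hn, hn', show -dn n - -dn (n + 1) = dn (n + 1) - dn n by ring, hdn_succ n, hmn]
    congr 2 <;> congr 1 <;> ring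
  · -- `m = -1`
    simp only [show (-1 : ℤ) + 1 = 0 by norm_num, le_refl, if_true, Int.toNat_zero,
      show ¬ ((0 : ℤ) ≤ -1) by norm_num, if_false, sub_neg_eq_add]
    have : up 0 = 0 := by simp [hup]
    rw [this, zero_add, show (-(-1 : ℤ)).toNat = 0 + 1 by norm_num, ← sub_zero (dn (0 + 1)),
      show (0 : ℝ) = dn 0 by simp [hdn], hdn_succ 0]
    norm_num
  · -- `0 ≤ m`
    have h1 : 0 ≤ m + 1 := by omega
    have h2 : 0 ≤ m := by omega
    simp only [h1, h2, if_true]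
    obtain ⟨n, hn⟩ : ∃ n : ℕ, m.toNat = n := ⟨_, rfl⟩
    have hn' : (m + 1).toNat = n + 1 := by omega
    have hmn : (n : ℤ) = m := by omega
    rw [hn, hn', hup_succ n, hmn]

/-- **Increments of the compressed heights over a block**: for `z'` with increments `min (z (m+1) - z m) 1` and gaps of
`z` at least `3/4`, over `n` consecutive layers the compressed increment is at most the original one, at least `3n/4`,
and either EQUAL to the original one or at least `1`. [folklore] -/
theorem gsc_sq_block (z z' : ℤ → ℝ) (hgap : ∀ m : ℤ, (3 : ℝ) / 4 ≤ z (m + 1) - z m)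
    (hz' : ∀ m : ℤ, z' (m + 1) - z' m = min (z (m + 1) - z m) 1) (m : ℤ) (n : ℕ) :
    z' (m + n) - z' m ≤ z (m + n) - z m ∧ (3 : ℝ) / 4 * n ≤ z' (m + n) - z' m ∧
    (z' (m + n) - z' m = z (m + n) - z m ∨ 1 ≤ z' (m + n) - z' m) := by
  induction n with
  | zero => simp
  | succ n ih =>
    obtain ⟨h1, h2, h3⟩ := ih
    have e1 : z' (m + ((n + 1 : ℕ) : ℤ)) - z' m = (z' (m + n) - z' m) + (z' (m + n + 1) - z' (m + n)) := by
      push_cast; ring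
    have e2 : z (m + ((n + 1 : ℕ) : ℤ)) - z m = (z (m + n) - z m) + (z (m + n + 1) - z (m + n)) := by
      push_cast; ring
    have hstep := hz' (m + n)
    have hg := hgap (m + n)
    have hmin : (3 : ℝ) / 4 ≤ min (z (m + n + 1) - z (m + n)) 1 := le_min hg (by norm_num)
    have hn0 : (0 : ℝ) ≤ (3 : ℝ) / 4 * n := by positivity
    refine ⟨?_, ?_, ?_⟩
    · rw [e1, e2, hstep]
      linarith [min_le_left (z (m + n + 1) - z (m + n)) 1]
    · rw [e1, hstep]
      push_cast
      linarith
    · rcases le_or_gt (z (m + n + 1) - z (m + n)) 1 with hle | hlt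
      · rw [min_eq_left hle] at hstep
        rcases h3 with h3 | h3
        · left
          rw [e1, e2, hstep, h3]
        · right
          rw [e1, hstep]
          linarith
      · right
        rw [min_eq_right hlt.le] at hstep
        rw [e1, hstep]
        linarith

/-- **The compression shortens height differences, never below `1`**: `|z' m - z' m'| ≤ |z m - z m'|`, with
`|z' m - z' m'| ≥ 1` whenever the inequality is strict, and `|z' m - z' m'| ≥ 3/4` for `m ≠ m'`. [folklore] -/
theorem gsc_sq_abs (z z' : ℤ → ℝ) (hgap : ∀ m : ℤ, (3 : ℝ) / 4 ≤ z (m + 1) - z m)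
    (hz' : ∀ m : ℤ, z' (m + 1) - z' m = min (z (m + 1) - z m) 1) (m m' : ℤ) :
    |z' m - z' m'| ≤ |z m - z m'| ∧ (|z' m - z' m'| < |z m - z m'| → 1 ≤ |z' m - z' m'|) ∧
    (m ≠ m' → (3 : ℝ) / 4 ≤ |z' m - z' m'|) := by
  -- reduce to `m ≤ m'` by symmetry of the statement
  wlog hle : m ≤ m' generalizing m m'
  · obtain ⟨h1, h2, h3⟩ := this m' m (le_of_not_ge hle)
    refine ⟨by rwa [abs_sub_comm, abs_sub_comm (z m)], fun h => ?_, fun h => ?_⟩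
    · rw [abs_sub_comm, abs_sub_comm (z m)] at h
      rw [abs_sub_comm]; exact h2 h
    · rw [abs_sub_comm]; exact h3 (Ne.symm h)
  obtain ⟨n, rfl⟩ : ∃ n : ℕ, m' = m + n := ⟨(m' - m).toNat, by omega⟩
  obtain ⟨h1, h2, h3⟩ := gsc_sq_block z z' hgap hz' m n
  have hn0 : (0 : ℝ) ≤ (3 : ℝ) / 4 * n := by positivity
  have hz'0 : 0 ≤ z' (m + n) - z' m := hn0.trans h2
  have hz0 : 0 ≤ z (m + n) - z m := hz'0.trans h1
  rw [abs_sub_comm, abs_of_nonneg hz'0, abs_sub_comm, abs_of_nonneg hz0]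
  refine ⟨h1, fun hlt => ?_, fun hne => ?_⟩
  · rcases h3 with h3 | h3
    · exact absurd h3 hlt.ne
    · exact h3
  · have hn1 : 1 ≤ n := by
      rcases Nat.eq_zero_or_pos n with rfl | hpos
      · simp at hne
      · exact hpos
    have : (1 : ℝ) ≤ n := by exact_mod_cast hn1
    linarith

/-- The compressed heights are strictly increasing. [folklore] -/
theorem gsc_sq_strictMono (z z' : ℤ → ℝ) (hgap : ∀ m : ℤ, (3 : ℝ) / 4 ≤ z (m + 1) - z m)
    (hz' : ∀ m : ℤ, z' (m + 1) - z' m = min (z (m + 1) - z m) 1) : StrictMono z' :=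
  strictMono_int_of_lt_succ fun m => by
    have h := hz' m
    have : (3 : ℝ) / 4 ≤ min (z (m + 1) - z m) 1 := le_min (hgap m) (by norm_num)
    linarith

/-- The compressed gaps are in `[3/4, 1]`. [folklore] -/
theorem gsc_sq_gap (z z' : ℤ → ℝ) (hgap : ∀ m : ℤ, (3 : ℝ) / 4 ≤ z (m + 1) - z m)
    (hz' : ∀ m : ℤ, z' (m + 1) - z' m = min (z (m + 1) - z m) 1) (m : ℤ) :
    (3 : ℝ) / 4 ≤ z' (m + 1) - z' m ∧ z' (m + 1) - z' m ≤ 1 := by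
  rw [hz' m]
  exact ⟨le_min (hgap m) (by norm_num), min_le_right _ _⟩

/-! ## The parametrisation of a general layered set -/

/-- Height of a layered point: `(B (i v₁ + j v₂ + δ m + s e₃)) 2 = s`. [folklore] -/
theorem gsc_pt_two {a : ℝ} {B : EuclideanSpace ℝ (Fin 3) ≃ₗᵢ[ℝ] EuclideanSpace ℝ (Fin 3)}
    {δ : ℤ → EuclideanSpace ℝ (Fin 3)} (hB : ∀ p : EuclideanSpace ℝ (Fin 3), (B p) 2 = p 2)
    (hδ : ∀ m : ℤ, (δ m) 2 = 0) (m : ℤ) (i j s : ℝ) :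
    (B (i • triangularVec₁ a + j • triangularVec₂ a + δ m + s • layerNormal 1)) 2 = s := by
  rw [hB, PiLp.add_apply, PiLp.add_apply, PiLp.add_apply, PiLp.smul_apply, PiLp.smul_apply, hδ,
    gsc_triangularVec₁_two, gsc_triangularVec₂_two, gsc_smul_layerNormal_two]
  simp

/-- The horizontal part of the difference of two layered points is horizontal. [folklore] -/
theorem gsc_horiz_two {a : ℝ} {δ : ℤ → EuclideanSpace ℝ (Fin 3)} (hδ : ∀ m : ℤ, (δ m) 2 = 0) (m m' : ℤ)
    (i j : ℝ) : (i • triangularVec₁ a + j • triangularVec₂ a + (δ m - δ m')) 2 = 0 := by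
  rw [PiLp.add_apply, PiLp.add_apply, PiLp.smul_apply, PiLp.smul_apply, PiLp.sub_apply, hδ, hδ,
    gsc_triangularVec₁_two, gsc_triangularVec₂_two]
  simp

/-- **Squared distance of two layered points** = squared norm of the horizontal difference + squared height
difference. [folklore] -/
theorem gsc_dist_sq {a : ℝ} {B : EuclideanSpace ℝ (Fin 3) ≃ₗᵢ[ℝ] EuclideanSpace ℝ (Fin 3)}
    {δ : ℤ → EuclideanSpace ℝ (Fin 3)} (hδ : ∀ m : ℤ, (δ m) 2 = 0) (m m' : ℤ) (i j i' j' s s' : ℝ) :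
    dist (B (i • triangularVec₁ a + j • triangularVec₂ a + δ m + s • layerNormal 1))
        (B (i' • triangularVec₁ a + j' • triangularVec₂ a + δ m' + s' • layerNormal 1)) ^ 2 =
      ‖(i - i') • triangularVec₁ a + (j - j') • triangularVec₂ a + (δ m - δ m')‖ ^ 2 + (s - s') ^ 2 := by
  rw [LinearIsometryEquiv.dist_map, dist_eq_norm]
  have e : i • triangularVec₁ a + j • triangularVec₂ a + δ m + s • layerNormal 1 -
      (i' • triangularVec₁ a + j' • triangularVec₂ a + δ m' + s' • layerNormal 1) =
      ((i - i') • triangularVec₁ a + (j - j') • triangularVec₂ a + (δ m - δ m')) + (s - s') • layerNormal 1 := by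
    module
  rw [e, gsc_norm_sq_horiz_add _ (gsc_horiz_two hδ m m' _ _)]

/-- **Injectivity of the parametrisation**: heights separate the layers, and `v₁, v₂` are independent. [folklore] -/
theorem gsc_param_injective {a : ℝ} (ha : 0 < a) {B : EuclideanSpace ℝ (Fin 3) ≃ₗᵢ[ℝ] EuclideanSpace ℝ (Fin 3)}
    {δ : ℤ → EuclideanSpace ℝ (Fin 3)} {z : ℤ → ℝ} (hB : ∀ p : EuclideanSpace ℝ (Fin 3), (B p) 2 = p 2)
    (hδ : ∀ m : ℤ, (δ m) 2 = 0) (hz : Function.Injective z) :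
    Function.Injective fun t : ℤ × ℤ × ℤ => B (((t.2.1 : ℝ)) • triangularVec₁ a + ((t.2.2 : ℝ)) • triangularVec₂ a +
      δ t.1 + z t.1 • layerNormal 1) := by
  rintro ⟨m, i, j⟩ ⟨m', i', j'⟩ h
  dsimp only at h
  have hm : m = m' := by
    have h2 := congrArg (fun v : EuclideanSpace ℝ (Fin 3) => v 2) h
    simp only [gsc_pt_two hB hδ] at h2
    exact hz h2
  subst hm
  have h' := B.injective h
  have hv : ((i : ℝ) - i') • triangularVec₁ a + ((j : ℝ) - j') • triangularVec₂ a = 0 := by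
    have : ((i : ℝ) - i') • triangularVec₁ a + ((j : ℝ) - j') • triangularVec₂ a =
        ((i : ℝ) • triangularVec₁ a + (j : ℝ) • triangularVec₂ a + δ m + z m • layerNormal 1) -
        ((i' : ℝ) • triangularVec₁ a + (j' : ℝ) • triangularVec₂ a + δ m + z m • layerNormal 1) := by module
    rw [this, h', sub_self]
  have h1 := congrArg (fun v : EuclideanSpace ℝ (Fin 3) => v 1) hv
  have h0 := congrArg (fun v : EuclideanSpace ℝ (Fin 3) => v 0) hv
  simp only [triangularVec₁, triangularVec₂, PiLp.add_apply, PiLp.smul_apply, PiLp.zero_apply, smul_eq_mul] at h0 h1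
  simp only [Matrix.cons_val_one, Matrix.cons_val_zero] at h0 h1
  have hs3 : (0 : ℝ) < √3 := Real.sqrt_pos.2 (by norm_num)
  have hj : (j : ℝ) = j' := by nlinarith [mul_pos ha hs3]
  have hi : (i : ℝ) = i' := by nlinarith
  have hj' : j = j' := by exact_mod_cast hj
  have hi' : i = i' := by exact_mod_cast hi
  rw [hi', hj']

/-- The layered set is the range of its parametrisation. [folklore] -/
theorem gsc_range_param {a : ℝ} (B : EuclideanSpace ℝ (Fin 3) ≃ₗᵢ[ℝ] EuclideanSpace ℝ (Fin 3))
    (δ : ℤ → EuclideanSpace ℝ (Fin 3)) (z : ℤ → ℝ) :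
    Set.range (fun t : ℤ × ℤ × ℤ => B (((t.2.1 : ℝ)) • triangularVec₁ a + ((t.2.2 : ℝ)) • triangularVec₂ a +
      δ t.1 + z t.1 • layerNormal 1)) =
    (fun p => B p) '' {p | ∃ m i j : ℤ, p = ((i : ℝ) • triangularVec₁ a) +
      ((j : ℝ) • triangularVec₂ a) + δ m + (z m • layerNormal 1)} := by
  ext q
  constructor
  · rintro ⟨⟨m, i, j⟩, rfl⟩
    exact ⟨_, ⟨m, i, j, rfl⟩, rfl⟩
  · rintro ⟨p, ⟨m, i, j, rfl⟩, rfl⟩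
    exact ⟨(m, i, j), rfl⟩

/-! ## Site energies over the parametrisation -/

/-- **Re-indexing the punctured site sum by the parameters**: for an injective parametrisation `P` of `S`, the sum
over `{q ∈ S, q ≠ P t₀}` of any `f` is the sum of `f ∘ P` over `{t ≠ t₀}`, and one is summable iff the other is.
[folklore] -/
theorem gsc_reindex {P : ℤ × ℤ × ℤ → EuclideanSpace ℝ (Fin 3)} (hinj : Function.Injective P)
    {S : Set (EuclideanSpace ℝ (Fin 3))} (hS : Set.range P = S) (t₀ : ℤ × ℤ × ℤ) (f : EuclideanSpace ℝ (Fin 3) → ℝ) :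
    (∑' q : {q : EuclideanSpace ℝ (Fin 3) // q ∈ S ∧ q ≠ P t₀}, f q) = ∑' t : {t : ℤ × ℤ × ℤ // t ≠ t₀}, f (P t) ∧
    ((Summable fun q : {q : EuclideanSpace ℝ (Fin 3) // q ∈ S ∧ q ≠ P t₀} => f q) ↔
      Summable fun t : {t : ℤ × ℤ × ℤ // t ≠ t₀} => f (P t)) := by
  set g : {t : ℤ × ℤ × ℤ // t ≠ t₀} → {q : EuclideanSpace ℝ (Fin 3) // q ∈ S ∧ q ≠ P t₀} :=
    fun t => ⟨P t.1, by rw [← hS]; exact ⟨Set.mem_range_self _, fun h => t.2 (hinj h)⟩⟩ with hg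
  have hbij : Function.Bijective g := by
    constructor
    · intro t t' h
      have h1 := congrArg Subtype.val h
      exact Subtype.ext (hinj h1)
    · rintro ⟨q, hqS, hq⟩
      rw [← hS] at hqS
      obtain ⟨t, rfl⟩ := hqS
      exact ⟨⟨t, fun h => hq (by rw [h])⟩, rfl⟩
  set e := Equiv.ofBijective g hbij with he
  refine ⟨(Equiv.tsum_eq e fun q => f q.1).symm, ?_⟩
  rw [← Equiv.summable_iff e]
  exact Iff.rfl

/-- **Pair distances shrink under the compression, never below `1`**: with the same horizontal data, replacing the
heights `z` by the compressed heights `z'` gives a pair distance `d' ≤ d`, and `1 ≤ d'` whenever `d' < d`. [folklore] -/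
theorem gsc_dist_compare {a : ℝ} {B : EuclideanSpace ℝ (Fin 3) ≃ₗᵢ[ℝ] EuclideanSpace ℝ (Fin 3)}
    {δ : ℤ → EuclideanSpace ℝ (Fin 3)} (hδ : ∀ m : ℤ, (δ m) 2 = 0) {z z' : ℤ → ℝ}
    (hgap : ∀ m : ℤ, (3 : ℝ) / 4 ≤ z (m + 1) - z m) (hz' : ∀ m : ℤ, z' (m + 1) - z' m = min (z (m + 1) - z m) 1)
    (m m' : ℤ) (i j i' j' : ℝ) :
    dist (B (i • triangularVec₁ a + j • triangularVec₂ a + δ m + z' m • layerNormal 1))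
        (B (i' • triangularVec₁ a + j' • triangularVec₂ a + δ m' + z' m' • layerNormal 1)) ≤
      dist (B (i • triangularVec₁ a + j • triangularVec₂ a + δ m + z m • layerNormal 1))
        (B (i' • triangularVec₁ a + j' • triangularVec₂ a + δ m' + z m' • layerNormal 1)) ∧
    (dist (B (i • triangularVec₁ a + j • triangularVec₂ a + δ m + z' m • layerNormal 1))
        (B (i' • triangularVec₁ a + j' • triangularVec₂ a + δ m' + z' m' • layerNormal 1)) <
      dist (B (i • triangularVec₁ a + j • triangularVec₂ a + δ m + z m • layerNormal 1))
        (B (i' • triangularVec₁ a + j' • triangularVec₂ a + δ m' + z m' • layerNormal 1)) →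
      1 ≤ dist (B (i • triangularVec₁ a + j • triangularVec₂ a + δ m + z' m • layerNormal 1))
        (B (i' • triangularVec₁ a + j' • triangularVec₂ a + δ m' + z' m' • layerNormal 1))) := by
  set d' := dist (B (i • triangularVec₁ a + j • triangularVec₂ a + δ m + z' m • layerNormal 1))
        (B (i' • triangularVec₁ a + j' • triangularVec₂ a + δ m' + z' m' • layerNormal 1)) with hd'
  set d := dist (B (i • triangularVec₁ a + j • triangularVec₂ a + δ m + z m • layerNormal 1))
        (B (i' • triangularVec₁ a + j' • triangularVec₂ a + δ m' + z m' • layerNormal 1)) with hd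
  have e' : d' ^ 2 = ‖(i - i') • triangularVec₁ a + (j - j') • triangularVec₂ a + (δ m - δ m')‖ ^ 2 +
      (z' m - z' m') ^ 2 := gsc_dist_sq hδ m m' i j i' j' _ _
  have e : d ^ 2 = ‖(i - i') • triangularVec₁ a + (j - j') • triangularVec₂ a + (δ m - δ m')‖ ^ 2 +
      (z m - z m') ^ 2 := gsc_dist_sq hδ m m' i j i' j' _ _
  obtain ⟨h1, h2, -⟩ := gsc_sq_abs z z' hgap hz' m m'
  have hd0 : 0 ≤ d := dist_nonneg
  have hd'0 : 0 ≤ d' := dist_nonneg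
  have hsq : (z' m - z' m') ^ 2 ≤ (z m - z m') ^ 2 := by
    rw [← sq_abs, ← sq_abs (z m - z m')]
    exact pow_le_pow_left₀ (abs_nonneg _) h1 2
  have hle : d' ≤ d := by nlinarith
  refine ⟨hle, fun hlt => ?_⟩
  have hlt2 : (z' m - z' m') ^ 2 < (z m - z m') ^ 2 := by nlinarith
  have habs : |z' m - z' m'| < |z m - z m'| := by
    rw [← sq_abs, ← sq_abs (z m - z m')] at hlt2
    exact lt_of_pow_lt_pow_left₀ 2 (abs_nonneg _) hlt2
  have h1le := h2 habs
  have : 1 ≤ d' ^ 2 := by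
    rw [e']
    have : 1 ≤ (z' m - z' m') ^ 2 := by
      rw [← sq_abs]; nlinarith
    nlinarith [norm_nonneg ((i - i') • triangularVec₁ a + (j - j') • triangularVec₂ a + (δ m - δ m'))]
  nlinarith

/-- **Termwise monotonicity**: the Lennard-Jones interaction of a pair does not increase under the compression
(`V_LJ` is increasing on `[1, ∞)`). [folklore] -/
theorem gsc_term_le {a : ℝ} {B : EuclideanSpace ℝ (Fin 3) ≃ₗᵢ[ℝ] EuclideanSpace ℝ (Fin 3)}
    {δ : ℤ → EuclideanSpace ℝ (Fin 3)} (hδ : ∀ m : ℤ, (δ m) 2 = 0) {z z' : ℤ → ℝ}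
    (hgap : ∀ m : ℤ, (3 : ℝ) / 4 ≤ z (m + 1) - z m) (hz' : ∀ m : ℤ, z' (m + 1) - z' m = min (z (m + 1) - z m) 1)
    (m m' : ℤ) (i j i' j' : ℝ) :
    lennardJones (dist (B (i • triangularVec₁ a + j • triangularVec₂ a + δ m + z' m • layerNormal 1))
        (B (i' • triangularVec₁ a + j' • triangularVec₂ a + δ m' + z' m' • layerNormal 1))) ≤
      lennardJones (dist (B (i • triangularVec₁ a + j • triangularVec₂ a + δ m + z m • layerNormal 1))
        (B (i' • triangularVec₁ a + j' • triangularVec₂ a + δ m' + z m' • layerNormal 1))) := by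
  obtain ⟨hle, hone⟩ := gsc_dist_compare (B := B) hδ hgap hz' m m' i j i' j'
  rcases hle.lt_or_eq with hlt | heq
  · have h1 := hone hlt
    exact Literature.Barriers.AtomisticToContinuum.strictMonoOn_lennardJones.monotoneOn
      (Set.mem_Ici.2 h1) (Set.mem_Ici.2 (h1.trans hle)) hle
  · rw [heq]

/-! ## Summary of part 1 (registered helper statement) -/

/-- **The compressed heights (summary).** For heights `z : ℤ → ℝ` with gaps `≥ 3/4` there are compressed heights `z'`
with `z' 0 = 0`, increments `min (z (m+1) - z m) 1`, strictly increasing, such that every height difference weakly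
decreases and is at least `1` whenever it strictly decreases. [folklore] -/
theorem gsc_compression : ∀ z : ℤ → ℝ, (∀ m : ℤ, (3 : ℝ) / 4 ≤ z (m + 1) - z m) →
    ∃ z' : ℤ → ℝ, z' 0 = 0 ∧ (∀ m : ℤ, z' (m + 1) - z' m = min (z (m + 1) - z m) 1) ∧ StrictMono z' ∧
      ∀ m m' : ℤ, |z' m - z' m'| ≤ |z m - z m'| ∧ (|z' m - z' m'| < |z m - z m'| → 1 ≤ |z' m - z' m'|) := by
  intro z hgap
  obtain ⟨z', hz'0, hz'⟩ := gsc_exists_sq z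
  refine ⟨z', hz'0, hz', gsc_sq_strictMono z z' hgap hz', fun m m' => ?_⟩
  obtain ⟨h1, h2, -⟩ := gsc_sq_abs z z' hgap hz' m m'
  exact ⟨h1, h2⟩

end Summit.AtomisticToContinuum.Crystallization.Theorems.PeriodicWindowsDenseLaminarHull

end
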